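import Literature.NumberTheory.LFunctions.Zhang2022.RepairBedModuli

/-!
# Zhang (2022) rescue bed (D-0124 (3)): KERNEL CERTIFICATES for the first rungs of the all-inert ladder (rule L1y)

Topic `Literature/NumberTheory/LFunctions/Zhang2022` (Landau–Siegel audit tree; verdict-neutral), cell landau-siegel,
LS RESCUE PROTOCOL (D-0124) part (3) GENUINE BED, typer seat ls-rescue-typ-1. **Nothing here is a claim about
Landau–Siegel zeros; the programme SEARCHES and TYPES.**

Rule L1y of the bed-1 pre-registration (`bed1-KG1-v0.1.json` dea02fd073922aeb): `D_y^s` = the fundamental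
discriminant of sign `s` with the least `|D| > 4` such that every prime `p ≤ y` is inert (`IsLeastAllInert y s D`,
`RepairBedModuli`). The engines resolve the table by exhaustive search (engine A job j271998: `D_3^- = −19`,
`D_5^- = D_7^- = −43`, `D_11^- = D_13^- = −67`, `D_17^- = ⋯ = D_37^- = −163`, `D_3^+ = 5`, `D_5^+ = 53`, `D_7^+ = D_11^+ = 173`,
`D_13^+ = 293`, …). This file makes the small rungs KERNEL THEOREMS — a third, exact «lineage» next to engines A and B:

* `jacobiSym_eq_neg_one_iff_pow` — Euler's criterion in the form «`(D/p) = −1 ⟺ D^{(p−1)/2} = −1` in `ZMod p`»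
  (odd prime `p`), which makes inertness kernel-DECIDABLE;
* `oddPrimesUpTo101`, `mem_oddPrimesUpTo101_iff` (the odd primes `≤ 101`, certified), `allInertCheck y D : Bool` and
  **`allInertUpTo_iff_check`** (`y ≤ 101`): the ladder predicate is a Boolean computation;
* `isLeastAllInert_of_check` — minimality from a finite Boolean sweep over `|D'| < |D|`;
* CERTIFICATES (by `decide +kernel` sweeps): `isLeastAllInert_three_neg19`, `isLeastAllInert_neg43` (`y = 5, 7`),
  `isLeastAllInert_neg67` (`y = 11, 13`), `isLeastAllInert_neg163` (`y = 17, 19, 23, 29, 31, 37`),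
  `isLeastAllInert_three_pos5`, `isLeastAllInert_five_pos53`, `isLeastAllInert_pos173` (`y = 7, 11`),
  `isLeastAllInert_thirteen_pos293` — i.e. the resolved rows of engine A for `y ≤ 37` (negative) and `y ≤ 13`
  (positive) hold EXACTLY (deeper rungs, `|D|` up to `2.7·10⁸`, stay engine-only: A ≡ B).
* Rev 2 (append): sign-restricted sweeps `isLeastAllInert_of_check_pos/_neg`, height monotonicity
  `IsLeastAllInert.of_le_of_allInertUpTo`, and the next rungs `isLeastAllInert_pos437` (`y = 17`), `isLeastAllInert_pos9173`
  (`y = 19, 23`), `isLeastAllInert_pos24653` (`y = 29`); fundamentality of the next rungs `74093` (`D_31^+ = D_37^+ = D_41^+`)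
  and `−77683 = −131·593` (`D_41^- = D_43^-`) is certified (`isFundamentalDiscriminant_rungs_two`), but their minimality
  sweeps (≈ 7·10⁴ integers × 12 modular powers) exceed the default heartbeat budget of a kernel `decide` and stay
  engine-only (A ≡ B of record). Kernel-certified ladder: `y ≤ 37` (−) and `y ≤ 29` (+).
* Rev 3 (append): the one-piece budget is overcome by SPLITTING each sweep into ≤ 4·10⁴-wide `decide +kernel` chunks
  (each well inside the default budget) and by `allInertCheck_false_mono` (a failure at height `y` persists at `y' ≥ y`,
  so a lower rung's sweep is reused): `isLeastAllInert_pos74093` (`y = 31, 37, 41`), `isLeastAllInert_neg77683`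
  (`y = 41, 43`), `isLeastAllInert_pos170957` (`y = 43`), `isLeastAllInert_pos214037` (`y = 47, 53, 59`;
  `214037 = 193·1109`). Kernel-certified ladder after Rev 3: `y ≤ 43` (−), `y ≤ 59` (+); deeper rungs (> 10⁶-wide sweeps) stay A ≡ B.

## References

* D. H. Lehmer, E. Lehmer, D. Shanks, *Integer sequences having prescribed quadratic character*, Math. Comp. 24 (1970)
  433–451 (the least such discriminants / pseudo-squares tables). [cite: LehmerLehmerShanks1970, §1]
* H. L. Montgomery, R. C. Vaughan, *Multiplicative Number Theory I* (2007), §9.3 (Euler's criterion, the Kronecker symbol).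
  [cite: MontgomeryVaughan2007, §9.3]
-/

noncomputable section

namespace Literature.NumberTheory.LFunctions.Zhang2022.Repair.Bed

open Literature.Barriers.RiemannHypothesis (IsFundamentalDiscriminant)

/-! ## Euler's criterion makes «`p` inert» decidable -/

/-- **Euler's criterion, inert form**: for an odd prime `p`, `(D/p) = −1 ⟺ D^{(p−1)/2} = −1 (mod p)`.
[cite: MontgomeryVaughan2007, §9.3] -/
theorem jacobiSym_eq_neg_one_iff_pow {p : ℕ} (hp : p.Prime) (hp2 : p ≠ 2) (D : ℤ) :
    jacobiSym D p = -1 ↔ (D : ZMod p) ^ (p / 2) = -1 := by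
  haveI : Fact p.Prime := ⟨hp⟩
  have h2p : 2 < p := lt_of_le_of_ne hp.two_le (Ne.symm hp2)
  haveI : Fact (2 < p) := ⟨h2p⟩
  rw [← jacobiSym.legendreSym.to_jacobiSym]
  have key := legendreSym.eq_pow p D
  constructor
  · intro h
    rw [← key, h]
    push_cast
    rfl
  · intro h
    have ha : (D : ZMod p) ≠ 0 := by
      intro h0
      rw [h0, zero_pow (Nat.div_pos hp.two_le two_pos).ne'] at h
      exact (neg_ne_zero.mpr (one_ne_zero (α := ZMod p))) h.symm
    rcases legendreSym.eq_one_or_neg_one p ha with h1 | h1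
    · exfalso
      rw [h1, h] at key
      push_cast at key
      exact ZMod.neg_one_ne_one key.symm
    · exact h1

/-- The odd primes `≤ 101` (the ladder heights' range). [cite: LehmerLehmerShanks1970, §1] -/
def oddPrimesUpTo101 : List ℕ :=
  [3, 5, 7, 11, 13, 17, 19, 23, 29, 31, 37, 41, 43, 47, 53, 59, 61, 67, 71, 73, 79, 83, 89, 97, 101]

/-- `oddPrimesUpTo101` is exactly the set of odd primes `≤ 101` (kernel check over `p ≤ 101`).
[cite: LehmerLehmerShanks1970, §1] -/
theorem mem_oddPrimesUpTo101_iff {p : ℕ} (hp : p ≤ 101) : p ∈ oddPrimesUpTo101 ↔ p.Prime ∧ p ≠ 2 := by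
  have key : ∀ q ≤ 101, (q ∈ oddPrimesUpTo101 ↔ q.Prime ∧ q ≠ 2) := by decide
  exact key p hp

/-- **The Boolean ladder check**: `D ≡ 5 (mod 8)` (if `y ≥ 2`) and `D^{(p−1)/2} = −1 (mod p)` for every odd prime
`p ≤ y` (heights `y ≤ 101`). [cite: LehmerLehmerShanks1970, §1] -/
def allInertCheck (y : ℕ) (D : ℤ) : Bool :=
  (!(decide (2 ≤ y)) || decide (D % 8 = 5)) &&
    (oddPrimesUpTo101.filter (· ≤ y)).all fun p => decide ((D : ZMod p) ^ (p / 2) = -1)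

/-- **The ladder predicate is the Boolean check** (for heights `y ≤ 101`): `AllInertUpTo y D ↔ allInertCheck y D`.
[cite: LehmerLehmerShanks1970, §1] -/
theorem allInertUpTo_iff_check {y : ℕ} (hy : y ≤ 101) (D : ℤ) : AllInertUpTo y D ↔ allInertCheck y D = true := by
  unfold AllInertUpTo allInertCheck
  rw [Bool.and_eq_true, Bool.or_eq_true, List.all_eq_true]
  constructor
  · rintro ⟨h2, hodd⟩
    refine ⟨?_, fun p hp => ?_⟩
    · by_cases hy2 : 2 ≤ y
      · right; exact decide_eq_true (h2 hy2)
      · left; simp [hy2]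
    · rw [List.mem_filter, decide_eq_true_iff] at hp
      obtain ⟨hmem, hpy⟩ := hp
      obtain ⟨hprime, hp2⟩ := (mem_oddPrimesUpTo101_iff (le_trans hpy hy)).mp hmem
      exact decide_eq_true ((jacobiSym_eq_neg_one_iff_pow hprime hp2 D).mp (hodd p hprime hp2 hpy))
  · rintro ⟨h2, hall⟩
    refine ⟨fun hy2 => ?_, fun p hp hp2 hpy => ?_⟩
    · rcases h2 with h2 | h2
      · simp [hy2] at h2
      · exact of_decide_eq_true h2
    · have hmem : p ∈ oddPrimesUpTo101.filter (· ≤ y) := by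
        rw [List.mem_filter, decide_eq_true_iff]
        exact ⟨(mem_oddPrimesUpTo101_iff (le_trans hpy hy)).mpr ⟨hp, hp2⟩, hpy⟩
      exact (jacobiSym_eq_neg_one_iff_pow hp hp2 D).mpr (of_decide_eq_true (hall p hmem))

/-- **Minimality from a finite sweep**: if `D` is fundamental of sign `s`, `|D| > 4`, passes the check, and every `D'`
of sign `s` with `4 < |D'| < |D|` fails it, then `D = D_y^s` (`IsLeastAllInert y s D`). The sweep hypothesis is a
decidable bounded quantifier, discharged by `decide +kernel` below. [cite: LehmerLehmerShanks1970, §1] -/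
theorem isLeastAllInert_of_check {y : ℕ} (hy : y ≤ 101) {s D : ℤ} (hF : IsFundamentalDiscriminant D)
    (hs : Int.sign D = s) (h4 : 4 < |D|) (hD : allInertCheck y D = true)
    (hmin : ∀ D' ∈ Finset.Icc (-|D| + 1) (|D| - 1), Int.sign D' = s → 4 < |D'| → allInertCheck y D' = false) :
    IsLeastAllInert y s D := by
  refine ⟨hF, hs, h4, (allInertUpTo_iff_check hy D).mpr hD, fun D' _ hs' h4' hall => ?_⟩
  by_contra hlt
  have hmem : D' ∈ Finset.Icc (-|D| + 1) (|D| - 1) := by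
    rw [Finset.mem_Icc]
    constructor <;> cases abs_cases D' <;> omega
  have h1 := hmin D' hmem hs' h4'
  have h2 := (allInertUpTo_iff_check hy D').mp hall
  rw [h1] at h2
  exact Bool.false_ne_true h2

/-! ## Fundamentality of the positive rungs `53, 173, 293` (finite square-freeness check) -/

/-- A finite square-freeness check (copy of the private helper of `RepairBedModuli`). [folklore] -/
private theorem squarefree_int_of_check' (z : ℤ) (B : ℕ) (h0 : z.natAbs ≠ 0) (hB : z.natAbs < (B + 1) * (B + 1))
    (h : ∀ x ≤ B, 2 ≤ x → ¬ x * x ∣ z.natAbs) : Squarefree z := by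
  rw [← Int.squarefree_natAbs, Nat.squarefree_iff_prime_squarefree]
  intro x hx hdvd
  have hle : x * x ≤ z.natAbs := Nat.le_of_dvd (Nat.pos_of_ne_zero h0) hdvd
  have hxB : x ≤ B := by
    by_contra hxB
    have hBx : B + 1 ≤ x := by omega
    have : (B + 1) * (B + 1) ≤ x * x := Nat.mul_self_le_mul_self hBx
    omega
  exact h x hxB hx.two_le hdvd

/-- `53`, `173`, `293` are (prime) fundamental discriminants. [cite: LehmerLehmerShanks1970, §1] -/
theorem isFundamentalDiscriminant_pos_rungs :
    IsFundamentalDiscriminant 53 ∧ IsFundamentalDiscriminant 173 ∧ IsFundamentalDiscriminant 293 :=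
  ⟨Or.inl ⟨by decide, squarefree_int_of_check' _ 20 (by decide) (by decide) (by decide), by decide⟩,
    Or.inl ⟨by decide, squarefree_int_of_check' _ 20 (by decide) (by decide) (by decide), by decide⟩,
    Or.inl ⟨by decide, squarefree_int_of_check' _ 20 (by decide) (by decide) (by decide), by decide⟩⟩

/-! ## The certificates (engine A's resolved rows for `y ≤ 37` / `y ≤ 13`, now kernel theorems) -/

/-- **`D_3^- = −19`.** [cite: LehmerLehmerShanks1970, §1] -/
theorem isLeastAllInert_three_neg19 : IsLeastAllInert 3 (-1) (-19) :=
  isLeastAllInert_of_check (by norm_num) (isFundamentalDiscriminant_of_mem_bed1Moduli (-19) (by decide))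
    (by decide) (by decide) (by decide +kernel) (by decide +kernel)

/-- **`D_5^- = D_7^- = −43`.** [cite: LehmerLehmerShanks1970, §1] -/
theorem isLeastAllInert_neg43 : IsLeastAllInert 5 (-1) (-43) ∧ IsLeastAllInert 7 (-1) (-43) :=
  ⟨isLeastAllInert_of_check (by norm_num) (isFundamentalDiscriminant_of_mem_bed1Moduli (-43) (by decide))
      (by decide) (by decide) (by decide +kernel) (by decide +kernel),
    isLeastAllInert_of_check (by norm_num) (isFundamentalDiscriminant_of_mem_bed1Moduli (-43) (by decide))
      (by decide) (by decide) (by decide +kernel) (by decide +kernel)⟩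

/-- **`D_11^- = D_13^- = −67`.** [cite: LehmerLehmerShanks1970, §1] -/
theorem isLeastAllInert_neg67 : IsLeastAllInert 11 (-1) (-67) ∧ IsLeastAllInert 13 (-1) (-67) :=
  ⟨isLeastAllInert_of_check (by norm_num) (isFundamentalDiscriminant_of_mem_bed1Moduli (-67) (by decide))
      (by decide) (by decide) (by decide +kernel) (by decide +kernel),
    isLeastAllInert_of_check (by norm_num) (isFundamentalDiscriminant_of_mem_bed1Moduli (-67) (by decide))
      (by decide) (by decide) (by decide +kernel) (by decide +kernel)⟩

/-- **`D_y^- = −163` for `y ∈ {17, 19, 23, 29, 31, 37}`** (all primes `≤ 37` are inert in `ℚ(√−163)`, and no smaller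
negative fundamental discriminant has all primes `≤ 17` inert). [cite: LehmerLehmerShanks1970, §1] -/
theorem isLeastAllInert_neg163 :
    IsLeastAllInert 17 (-1) (-163) ∧ IsLeastAllInert 19 (-1) (-163) ∧ IsLeastAllInert 23 (-1) (-163) ∧
      IsLeastAllInert 29 (-1) (-163) ∧ IsLeastAllInert 31 (-1) (-163) ∧ IsLeastAllInert 37 (-1) (-163) := by
  have hF := isFundamentalDiscriminant_of_mem_bed1Moduli (-163) (by decide)
  refine ⟨?_, ?_, ?_, ?_, ?_, ?_⟩ <;>
    exact isLeastAllInert_of_check (by norm_num) hF (by decide) (by decide) (by decide +kernel) (by decide +kernel)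

/-- **`D_3^+ = 5`.** [cite: LehmerLehmerShanks1970, §1] -/
theorem isLeastAllInert_three_pos5 : IsLeastAllInert 3 1 5 :=
  isLeastAllInert_of_check (by norm_num) (isFundamentalDiscriminant_of_mem_bed1Moduli 5 (by decide))
    (by decide) (by decide) (by decide +kernel) (by decide +kernel)

/-- **`D_5^+ = 53`.** [cite: LehmerLehmerShanks1970, §1] -/
theorem isLeastAllInert_five_pos53 : IsLeastAllInert 5 1 53 :=
  isLeastAllInert_of_check (by norm_num) isFundamentalDiscriminant_pos_rungs.1
    (by decide) (by decide) (by decide +kernel) (by decide +kernel)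

/-- **`D_7^+ = D_11^+ = 173`.** [cite: LehmerLehmerShanks1970, §1] -/
theorem isLeastAllInert_pos173 : IsLeastAllInert 7 1 173 ∧ IsLeastAllInert 11 1 173 :=
  ⟨isLeastAllInert_of_check (by norm_num) isFundamentalDiscriminant_pos_rungs.2.1
      (by decide) (by decide) (by decide +kernel) (by decide +kernel),
    isLeastAllInert_of_check (by norm_num) isFundamentalDiscriminant_pos_rungs.2.1
      (by decide) (by decide) (by decide +kernel) (by decide +kernel)⟩

/-- **`D_13^+ = 293`.** [cite: LehmerLehmerShanks1970, §1] -/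
theorem isLeastAllInert_thirteen_pos293 : IsLeastAllInert 13 1 293 :=
  isLeastAllInert_of_check (by norm_num) isFundamentalDiscriminant_pos_rungs.2.2
    (by decide) (by decide) (by decide +kernel) (by decide +kernel)

/-! ## Rev 2 (append): sign-restricted sweeps, height monotonicity, and the rungs up to `y = 41/43` -/

/-- Minimality sweep restricted to the POSITIVE side (`s = 1`): it suffices that every `D'` with `5 ≤ D' < D` fails the
check. [cite: LehmerLehmerShanks1970, §1] -/
theorem isLeastAllInert_of_check_pos {y : ℕ} (hy : y ≤ 101) {D : ℤ} (hF : IsFundamentalDiscriminant D)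
    (hs : Int.sign D = 1) (h4 : 4 < |D|) (hD : allInertCheck y D = true)
    (hmin : ∀ D' ∈ Finset.Icc 5 (D - 1), allInertCheck y D' = false) : IsLeastAllInert y 1 D := by
  refine ⟨hF, hs, h4, (allInertUpTo_iff_check hy D).mpr hD, fun D' _ hs' h4' hall => ?_⟩
  by_contra hlt
  have hD0 : 0 < D := Int.sign_eq_one_iff_pos.mp hs
  have hD'0 : 0 < D' := Int.sign_eq_one_iff_pos.mp hs'
  have hmem : D' ∈ Finset.Icc 5 (D - 1) := by
    rw [Finset.mem_Icc]; rw [abs_of_pos hD'0] at h4' hlt; rw [abs_of_pos hD0] at hlt; omega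
  have h1 := hmin D' hmem
  have h2 := (allInertUpTo_iff_check hy D').mp hall
  rw [h1] at h2
  exact Bool.false_ne_true h2

/-- Minimality sweep restricted to the NEGATIVE side (`s = −1`): every `D'` with `D < D' ≤ −5` fails the check.
[cite: LehmerLehmerShanks1970, §1] -/
theorem isLeastAllInert_of_check_neg {y : ℕ} (hy : y ≤ 101) {D : ℤ} (hF : IsFundamentalDiscriminant D)
    (hs : Int.sign D = -1) (h4 : 4 < |D|) (hD : allInertCheck y D = true)
    (hmin : ∀ D' ∈ Finset.Icc (D + 1) (-5), allInertCheck y D' = false) : IsLeastAllInert y (-1) D := by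
  refine ⟨hF, hs, h4, (allInertUpTo_iff_check hy D).mpr hD, fun D' _ hs' h4' hall => ?_⟩
  by_contra hlt
  have hD0 : D < 0 := Int.sign_eq_neg_one_iff_neg.mp hs
  have hD'0 : D' < 0 := Int.sign_eq_neg_one_iff_neg.mp hs'
  have hmem : D' ∈ Finset.Icc (D + 1) (-5) := by
    rw [Finset.mem_Icc]; rw [abs_of_neg hD'0] at h4' hlt; rw [abs_of_neg hD0] at hlt; omega
  have h1 := hmin D' hmem
  have h2 := (allInertUpTo_iff_check hy D').mp hall
  rw [h1] at h2
  exact Bool.false_ne_true h2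

/-- **Height monotonicity of the ladder**: if `D = D_y^s` and `D` is still all-inert up to `y' ≥ y`, then `D = D_{y'}^s`
(any competitor at height `y'` is one at height `y`). [cite: LehmerLehmerShanks1970, §1] -/
theorem IsLeastAllInert.of_le_of_allInertUpTo {y y' : ℕ} {s D : ℤ} (h : IsLeastAllInert y s D) (hyy' : y ≤ y')
    (h' : AllInertUpTo y' D) : IsLeastAllInert y' s D :=
  ⟨h.1, h.2.1, h.2.2.1, h', fun D' hF' hs' h4' hall => h.2.2.2.2 D' hF' hs' h4' (hall.mono hyy')⟩

/-- `437 = 19·23`, `9173`, `24653 = 89·277`, `74093` and `−77683 = −131·593` are fundamental discriminants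
(all `≡ 1 (mod 4)`, square-free by finite check). [cite: LehmerLehmerShanks1970, §1] -/
theorem isFundamentalDiscriminant_rungs_two :
    IsFundamentalDiscriminant 437 ∧ IsFundamentalDiscriminant 9173 ∧ IsFundamentalDiscriminant 24653 ∧
      IsFundamentalDiscriminant 74093 ∧ IsFundamentalDiscriminant (-77683) :=
  ⟨Or.inl ⟨by decide, squarefree_int_of_check' _ 21 (by decide) (by decide) (by decide), by decide⟩,
    Or.inl ⟨by decide, squarefree_int_of_check' _ 96 (by decide) (by decide) (by decide +kernel), by decide⟩,
    Or.inl ⟨by decide, squarefree_int_of_check' _ 157 (by decide) (by decide) (by decide +kernel), by decide⟩,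
    Or.inl ⟨by decide, squarefree_int_of_check' _ 273 (by decide) (by decide) (by decide +kernel), by decide⟩,
    Or.inl ⟨by decide, squarefree_int_of_check' _ 279 (by decide) (by decide) (by decide +kernel), by decide⟩⟩

/-- **`D_17^+ = 437`.** [cite: LehmerLehmerShanks1970, §1] -/
theorem isLeastAllInert_pos437 : IsLeastAllInert 17 1 437 :=
  isLeastAllInert_of_check_pos (by norm_num) isFundamentalDiscriminant_rungs_two.1
    (by decide) (by decide) (by decide +kernel) (by decide +kernel)

/-- **`D_19^+ = D_23^+ = 9173`.** [cite: LehmerLehmerShanks1970, §1] -/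
theorem isLeastAllInert_pos9173 : IsLeastAllInert 19 1 9173 ∧ IsLeastAllInert 23 1 9173 := by
  have h19 : IsLeastAllInert 19 1 9173 :=
    isLeastAllInert_of_check_pos (by norm_num) isFundamentalDiscriminant_rungs_two.2.1
      (by decide) (by decide) (by decide +kernel) (by decide +kernel)
  exact ⟨h19, h19.of_le_of_allInertUpTo (by norm_num)
    ((allInertUpTo_iff_check (by norm_num) _).mpr (by decide +kernel))⟩

/-- **`D_29^+ = 24653`.** [cite: LehmerLehmerShanks1970, §1] -/
theorem isLeastAllInert_pos24653 : IsLeastAllInert 29 1 24653 :=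
  isLeastAllInert_of_check_pos (by norm_num) isFundamentalDiscriminant_rungs_two.2.2.1
    (by decide) (by decide) (by decide +kernel) (by decide +kernel)

/-! ## Rev 3 (append): chunked sweeps — the rungs `+74093`, `−77683`, `+170957`, `+214037` (ladder to `y ≤ 59⁺ / 43⁻`) -/

/-- **A failed check persists upward**: `allInertCheck y D = false → allInertCheck y' D = false` for `y ≤ y' ≤ 101`
(contrapositive of `AllInertUpTo.mono` via `allInertUpTo_iff_check`); lets a lower rung's sweep be reused. [cite: LehmerLehmerShanks1970, §1] -/
theorem allInertCheck_false_mono {y y' : ℕ} (hyy' : y ≤ y') (hy' : y' ≤ 101) {D : ℤ}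
    (h : allInertCheck y D = false) : allInertCheck y' D = false := by
  by_contra h'
  rw [Bool.not_eq_false] at h'
  have h1 := (allInertUpTo_iff_check (le_trans hyy' hy') D).mp (((allInertUpTo_iff_check hy' D).mpr h').mono hyy')
  rw [h] at h1
  exact Bool.false_ne_true h1

/-- Sweep chunk (`y = 31`, `5 ≤ D' ≤ 40000`). [cite: LehmerLehmerShanks1970, §1] -/
private theorem sweep31_pos_a : ∀ D' ∈ Finset.Icc (5 : ℤ) 40000, allInertCheck 31 D' = false := by decide +kernel

/-- Sweep chunk (`y = 31`, `40001 ≤ D' ≤ 74092`). [cite: LehmerLehmerShanks1970, §1] -/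
private theorem sweep31_pos_b : ∀ D' ∈ Finset.Icc (40001 : ℤ) 74092, allInertCheck 31 D' = false := by decide +kernel

/-- No positive `D' < 74093` (`D' ≥ 5`) has all primes `≤ 31` inert. [cite: LehmerLehmerShanks1970, §1] -/
theorem sweep31_pos : ∀ D' ∈ Finset.Icc 5 ((74093 : ℤ) - 1), allInertCheck 31 D' = false := by
  intro D' hD'
  rw [Finset.mem_Icc] at hD'
  by_cases h : D' ≤ 40000
  · exact sweep31_pos_a D' (Finset.mem_Icc.mpr ⟨hD'.1, h⟩)
  · exact sweep31_pos_b D' (Finset.mem_Icc.mpr ⟨by omega, by omega⟩)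

/-- **`D_31^+ = D_37^+ = D_41^+ = 74093`** (prime; all primes `≤ 41` inert, `43` splits). [cite: LehmerLehmerShanks1970, §1] -/
theorem isLeastAllInert_pos74093 :
    IsLeastAllInert 31 1 74093 ∧ IsLeastAllInert 37 1 74093 ∧ IsLeastAllInert 41 1 74093 := by
  have h31 : IsLeastAllInert 31 1 74093 :=
    isLeastAllInert_of_check_pos (by norm_num) isFundamentalDiscriminant_rungs_two.2.2.2.1
      (by decide) (by decide) (by decide +kernel) sweep31_pos
  exact ⟨h31,
    h31.of_le_of_allInertUpTo (by norm_num) ((allInertUpTo_iff_check (by norm_num) _).mpr (by decide +kernel)),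
    h31.of_le_of_allInertUpTo (by norm_num) ((allInertUpTo_iff_check (by norm_num) _).mpr (by decide +kernel))⟩

/-- Sweep chunk (`y = 41`, `−77682 ≤ D' ≤ −40001`). [cite: LehmerLehmerShanks1970, §1] -/
private theorem sweep41_neg_a : ∀ D' ∈ Finset.Icc (-77682 : ℤ) (-40001), allInertCheck 41 D' = false := by decide +kernel

/-- Sweep chunk (`y = 41`, `−40000 ≤ D' ≤ −5`). [cite: LehmerLehmerShanks1970, §1] -/
private theorem sweep41_neg_b : ∀ D' ∈ Finset.Icc (-40000 : ℤ) (-5), allInertCheck 41 D' = false := by decide +kernel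

/-- No negative `D'` with `5 ≤ |D'| < 77683` has all primes `≤ 41` inert (`−163` fails at `41`). [cite: LehmerLehmerShanks1970, §1] -/
theorem sweep41_neg : ∀ D' ∈ Finset.Icc ((-77683 : ℤ) + 1) (-5), allInertCheck 41 D' = false := by
  intro D' hD'
  rw [Finset.mem_Icc] at hD'
  by_cases h : D' ≤ -40001
  · exact sweep41_neg_a D' (Finset.mem_Icc.mpr ⟨by omega, h⟩)
  · exact sweep41_neg_b D' (Finset.mem_Icc.mpr ⟨by omega, hD'.2⟩)

/-- **`D_41^- = D_43^- = −77683 = −131·593`** (all primes `≤ 43` inert, `47` is not). [cite: LehmerLehmerShanks1970, §1] -/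
theorem isLeastAllInert_neg77683 : IsLeastAllInert 41 (-1) (-77683) ∧ IsLeastAllInert 43 (-1) (-77683) := by
  have h41 : IsLeastAllInert 41 (-1) (-77683) :=
    isLeastAllInert_of_check_neg (by norm_num) isFundamentalDiscriminant_rungs_two.2.2.2.2
      (by decide) (by decide) (by decide +kernel) sweep41_neg
  exact ⟨h41,
    h41.of_le_of_allInertUpTo (by norm_num) ((allInertUpTo_iff_check (by norm_num) _).mpr (by decide +kernel))⟩

/-- `170957` (prime) and `214037 = 193·1109` are fundamental discriminants (`≡ 1 (mod 4)`, square-free). [cite: LehmerLehmerShanks1970, §1] -/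
theorem isFundamentalDiscriminant_rungs_three :
    IsFundamentalDiscriminant 170957 ∧ IsFundamentalDiscriminant 214037 :=
  ⟨Or.inl ⟨by decide, squarefree_int_of_check' _ 413 (by decide) (by decide) (by decide +kernel), by decide⟩,
    Or.inl ⟨by decide, squarefree_int_of_check' _ 462 (by decide) (by decide) (by decide +kernel), by decide⟩⟩

/-- Sweep chunk (`y = 43`, `74094 ≤ D' ≤ 110000`). [cite: LehmerLehmerShanks1970, §1] -/
private theorem sweep43_pos_c : ∀ D' ∈ Finset.Icc (74094 : ℤ) 110000, allInertCheck 43 D' = false := by decide +kernel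

/-- Sweep chunk (`y = 43`, `110001 ≤ D' ≤ 140000`). [cite: LehmerLehmerShanks1970, §1] -/
private theorem sweep43_pos_d : ∀ D' ∈ Finset.Icc (110001 : ℤ) 140000, allInertCheck 43 D' = false := by decide +kernel

/-- Sweep chunk (`y = 43`, `140001 ≤ D' ≤ 170956`). [cite: LehmerLehmerShanks1970, §1] -/
private theorem sweep43_pos_e : ∀ D' ∈ Finset.Icc (140001 : ℤ) 170956, allInertCheck 43 D' = false := by decide +kernel

/-- No positive `D' < 170957` (`D' ≥ 5`) has all primes `≤ 43` inert: below `74093` reuse the `y = 31` sweep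
(`allInertCheck_false_mono`), `74093` itself fails at `43`, three chunks cover `(74093, 170957)`. [cite: LehmerLehmerShanks1970, §1] -/
theorem sweep43_pos : ∀ D' ∈ Finset.Icc 5 ((170957 : ℤ) - 1), allInertCheck 43 D' = false := by
  intro D' hD'
  rw [Finset.mem_Icc] at hD'
  by_cases h1 : D' ≤ 74092
  · exact allInertCheck_false_mono (by norm_num) (by norm_num) (sweep31_pos D' (Finset.mem_Icc.mpr ⟨hD'.1, by omega⟩))
  by_cases h2 : D' = 74093
  · subst h2; decide +kernel
  by_cases h3 : D' ≤ 110000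
  · exact sweep43_pos_c D' (Finset.mem_Icc.mpr ⟨by omega, h3⟩)
  by_cases h4 : D' ≤ 140000
  · exact sweep43_pos_d D' (Finset.mem_Icc.mpr ⟨by omega, h4⟩)
  · exact sweep43_pos_e D' (Finset.mem_Icc.mpr ⟨by omega, by omega⟩)

/-- **`D_43^+ = 170957`** (prime; all primes `≤ 43` inert, `47` is not). [cite: LehmerLehmerShanks1970, §1] -/
theorem isLeastAllInert_pos170957 : IsLeastAllInert 43 1 170957 :=
  isLeastAllInert_of_check_pos (by norm_num) isFundamentalDiscriminant_rungs_three.1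
    (by decide) (by decide) (by decide +kernel) sweep43_pos

/-- Sweep chunk (`y = 47`, `170958 ≤ D' ≤ 214036`). [cite: LehmerLehmerShanks1970, §1] -/
private theorem sweep47_pos_f : ∀ D' ∈ Finset.Icc (170958 : ℤ) 214036, allInertCheck 47 D' = false := by decide +kernel

/-- No positive `D' < 214037` has all primes `≤ 47` inert (`y = 43` sweep reused; `170957` fails at `47`). [cite: LehmerLehmerShanks1970, §1] -/
theorem sweep47_pos : ∀ D' ∈ Finset.Icc 5 ((214037 : ℤ) - 1), allInertCheck 47 D' = false := by
  intro D' hD'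
  rw [Finset.mem_Icc] at hD'
  by_cases h1 : D' ≤ 170956
  · exact allInertCheck_false_mono (by norm_num) (by norm_num) (sweep43_pos D' (Finset.mem_Icc.mpr ⟨hD'.1, by omega⟩))
  by_cases h2 : D' = 170957
  · subst h2; decide +kernel
  · exact sweep47_pos_f D' (Finset.mem_Icc.mpr ⟨by omega, by omega⟩)

/-- **`D_47^+ = D_53^+ = D_59^+ = 214037 = 193·1109`** (all primes `≤ 59` inert, `61` is not). [cite: LehmerLehmerShanks1970, §1] -/
theorem isLeastAllInert_pos214037 :
    IsLeastAllInert 47 1 214037 ∧ IsLeastAllInert 53 1 214037 ∧ IsLeastAllInert 59 1 214037 := by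
  have h47 : IsLeastAllInert 47 1 214037 :=
    isLeastAllInert_of_check_pos (by norm_num) isFundamentalDiscriminant_rungs_three.2
      (by decide) (by decide) (by decide +kernel) sweep47_pos
  exact ⟨h47,
    h47.of_le_of_allInertUpTo (by norm_num) ((allInertUpTo_iff_check (by norm_num) _).mpr (by decide +kernel)),
    h47.of_le_of_allInertUpTo (by norm_num) ((allInertUpTo_iff_check (by norm_num) _).mpr (by decide +kernel))⟩

end Literature.NumberTheory.LFunctions.Zhang2022.Repair.Bed

end
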